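import Mathlib
import Summits.ValiantsHypothesis.ValiantsHypothesis.Theorems.GeneratorObstructionsPowGenDegreeQPEvaluationLateness
import Summits.ValiantsHypothesis.ValiantsHypothesis.Theorems.GeneratorObstructionsGenFlipThesisChowDichotomy

/-!
# Route GeneratorObstructions — crux K2 `PowGenDegreeQP` (stmt-ValiantsHypothesis-11655), line
# `trace-side-regimes`: the DOUBLING GADGET — a sparse easy form whose stabiliser torus forces
# exponentially late admissible weights

Helper file (`--supports stmt-ValiantsHypothesis-11655`), the arithmetic half of the conditional
refutation format `…EvaluationLateness.not_powGenDegreeQP_of_evalLate`.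

**The gadget.** On a finite linearly ordered alphabet `σ` take `3c` letters
`B 0 < A 0 < B 1 < A' 0 < A 1 < B 2 < A' 1 < … < A (c-1) < A' (c-1)`, i.e. any injections
`B A A' : Fin c → σ` with `A j < B (j+1) < A' j`, and the form
`g = Σ_j x_{B j}^k · x_{A j}^{2k} · x_{A' j}^{2k}` of degree `m = 5k` (`c` monomials in disjoint letters:
a width-`c` ABP, `pc(g) ≤ 5k·c`).  Its diagonal stabiliser contains, for every `j`, the scalings
`x_{B j} ↦ 4 x_{B j}, x_{A j} ↦ ½ x_{A j}` and `x_{A j} ↦ 2 x_{A j}, x_{A' j} ↦ ½ x_{A' j}`, and the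
scaling `x_u ↦ 2 x_u` of every letter `u` outside the gadget.

1. `neg_size_ge_pow_of_doubling` — ARITHMETIC: a nonpositive ANTITONE weight `χ` with
   `χ(A j) = χ(A' j) = 2 χ(B j)` for all `j` and `χ(B 0) ≠ 0` has `-|χ| ≥ 2^c`: antitonicity across
   `A j < B (j+1) < A' j` squeezes `χ(B (j+1)) = 2 χ(B j)`, so `χ(B j) = 2^j χ(B 0)` (the weights
   admissible at `g` DOUBLE along the chain).
2. `weight_relations_of_gadget_stabilizer` — the stabiliser scalings above force exactly these
   relations (and `χ = 0` off the gadget) on every weight annihilated by them; with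
   `eq_zero_of_relations` the only such weight with `χ(B 0) = 0` is `χ = 0`.
3. `gadget_lateness_package` — hence the hypotheses `hS`, `harith` of
   `exists_late_genType_of_stabilizer` hold for `g` with `D = 2^c`: every nonzero occurring weight
   annihilated by the stabiliser has `-|χ| ≥ 2^c`.  (The companion file `…DoublingGadgetEasy` adds:
   the gadget is a power trace of size `5k·c`, and K2 bounds `2^c` by `5k · 2^((log₂ 5k + c₀)^c₀)`
   in every window cell where one nonconstant semi-invariant is nonzero at `g`.)

What is NOT proved here (recorded on the item as the one missing input): the existence of a
nonconstant highest-weight vector not vanishing at `g` — by the Kempf–Hilbert–Mumford criterion for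
the pair `(g, v_χ)` this holds iff `-χ ∈ cone(supp g)` for some admissible `χ`, and
`-χ* = Σ_j 2^j · (k e_{B j} + 2k e_{A j} + 2k e_{A' j})` is such a weight; typing that criterion
(Kempf 1978 Thm. 3.4/Cor. 3.5 + Mumford) is a separate Literature task.  Honest framing: arithmetic
and stabiliser bookkeeping for an explicit candidate; no stub, crux or summit is settled;
`VP ≠ VNP` untouched.

References: Derksen–Makam, Adv. Math. 368 (2020) §1 (torus weights forcing exponential degrees);
G. Kempf, Ann. of Math. 108 (1978).
-/

namespace Summit.ValiantsHypothesis.ValiantsHypothesis.Theorems.GeneratorObstructions.PowGenDegreeQP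

open MvPolynomial
open Literature.NumberTheory.DiophantineGeometry Literature.Computability.AlgebraicComplexity
  Literature.Barriers.ValiantsHypothesis
open Summit.ValiantsHypothesis.ValiantsHypothesis.Theses.GeneratorObstructions
open Summit.ValiantsHypothesis.ValiantsHypothesis.Theorems.GeneratorObstructions.SliceTransfer
open Summit.ValiantsHypothesis.ValiantsHypothesis.Theorems.GeneratorObstructions.ChowDichotomy

-- `Summit.ValiantsHypothesis.ValiantsHypothesis.…` is the tree's mandated single-conjunct layout.
set_option linter.dupNamespace false

noncomputable section

section Arithmetic

variable {σ : Type*} [Fintype σ] [LinearOrder σ] {c : ℕ}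

omit [Fintype σ] in
/-- **Doubling along the chain.** If `χ` is antitone with `χ(A j) = χ(A' j) = 2 χ(B j)` and the
letters interleave as `A j < B (j+1) < A' j`, then `χ(B (j+1)) = 2 χ(B j)`. [folklore] -/
theorem apply_B_succ_of_doubling (B A A' : Fin c → σ) (χ : Weight σ) (hanti : Antitone χ)
    (hA : ∀ j, χ (A j) = 2 * χ (B j)) (hA' : ∀ j, χ (A' j) = 2 * χ (B j))
    (hord1 : ∀ (j : Fin c) (h : j.val + 1 < c), A j < B ⟨j.val + 1, h⟩)
    (hord2 : ∀ (j : Fin c) (h : j.val + 1 < c), B ⟨j.val + 1, h⟩ < A' j)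
    (j : Fin c) (h : j.val + 1 < c) : χ (B ⟨j.val + 1, h⟩) = 2 * χ (B j) := by
  have h1 : χ (B ⟨j.val + 1, h⟩) ≤ χ (A j) := hanti (hord1 j h).le
  have h2 : χ (A' j) ≤ χ (B ⟨j.val + 1, h⟩) := hanti (hord2 j h).le
  rw [hA] at h1
  rw [hA'] at h2
  exact le_antisymm h1 h2

omit [Fintype σ] in
/-- Hence `χ(B j) = 2^j χ(B 0)` along the chain. [folklore] -/
theorem apply_B_eq_pow_mul (B A A' : Fin c → σ) (χ : Weight σ) (hanti : Antitone χ)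
    (hA : ∀ j, χ (A j) = 2 * χ (B j)) (hA' : ∀ j, χ (A' j) = 2 * χ (B j))
    (hord1 : ∀ (j : Fin c) (h : j.val + 1 < c), A j < B ⟨j.val + 1, h⟩)
    (hord2 : ∀ (j : Fin c) (h : j.val + 1 < c), B ⟨j.val + 1, h⟩ < A' j)
    (hc : 0 < c) : ∀ (n : ℕ) (hn : n < c), χ (B ⟨n, hn⟩) = 2 ^ n * χ (B ⟨0, hc⟩) := by
  intro n
  induction n with
  | zero => intro hn; simp
  | succ n ih =>
    intro hn
    have h := apply_B_succ_of_doubling B A A' χ hanti hA hA' hord1 hord2 ⟨n, by omega⟩ hn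
    rw [h, ih (by omega), pow_succ]
    ring

/-- **Arithmetic of the doubling gadget.** A nonpositive antitone weight with the gadget relations
`χ(A j) = χ(A' j) = 2 χ(B j)`, interleaved letters `A j < B (j+1) < A' j`, and `χ(B 0) ≠ 0` has
`-|χ| ≥ 2^c` (indeed `-χ(A (c-1)) = -2^c χ(B 0) ≥ 2^c`). [folklore] -/
theorem pow_le_neg_size_of_doubling (B A A' : Fin c → σ) (χ : Weight σ) (hanti : Antitone χ)
    (hnonpos : ∀ i, χ i ≤ 0)
    (hA : ∀ j, χ (A j) = 2 * χ (B j)) (hA' : ∀ j, χ (A' j) = 2 * χ (B j))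
    (hord1 : ∀ (j : Fin c) (h : j.val + 1 < c), A j < B ⟨j.val + 1, h⟩)
    (hord2 : ∀ (j : Fin c) (h : j.val + 1 < c), B ⟨j.val + 1, h⟩ < A' j)
    (hc : 0 < c) (hB0 : χ (B ⟨0, hc⟩) ≠ 0) : (2 : ℤ) ^ c ≤ -(Weight.size χ) := by
  have hlast := apply_B_eq_pow_mul B A A' χ hanti hA hA' hord1 hord2 hc (c - 1) (by omega)
  have hAlast : χ (A ⟨c - 1, by omega⟩) = 2 ^ c * χ (B ⟨0, hc⟩) := by
    rw [hA, hlast, ← mul_assoc]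
    congr 1
    rw [← pow_succ']
    congr 1
    omega
  have hneg : χ (B ⟨0, hc⟩) ≤ -1 := by
    have := hnonpos (B ⟨0, hc⟩)
    omega
  -- `-|χ| = Σ (-χ i) ≥ -χ(A (c-1))`
  have hsum : -(Weight.size χ) = ∑ i, (-χ i) := by
    rw [Weight.size, Finset.sum_neg_distrib]
  have hsingle : -χ (A ⟨c - 1, by omega⟩) ≤ ∑ i, (-χ i) :=
    Finset.single_le_sum (f := fun i => -χ i) (fun i _ => by have := hnonpos i; omega)
      (Finset.mem_univ _)
  rw [hsum]
  refine le_trans ?_ hsingle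
  rw [hAlast]
  have h2c : (0 : ℤ) < 2 ^ c := by positivity
  nlinarith

omit [Fintype σ] in
/-- If moreover `χ` vanishes off the gadget letters and `χ(B 0) = 0`, then `χ = 0`. [folklore] -/
theorem eq_zero_of_relations (B A A' : Fin c → σ) (χ : Weight σ) (hanti : Antitone χ)
    (hA : ∀ j, χ (A j) = 2 * χ (B j)) (hA' : ∀ j, χ (A' j) = 2 * χ (B j))
    (hord1 : ∀ (j : Fin c) (h : j.val + 1 < c), A j < B ⟨j.val + 1, h⟩)
    (hord2 : ∀ (j : Fin c) (h : j.val + 1 < c), B ⟨j.val + 1, h⟩ < A' j)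
    (hoff : ∀ x, (∀ j, x ≠ B j) → (∀ j, x ≠ A j) → (∀ j, x ≠ A' j) → χ x = 0)
    (hc : 0 < c) (hB0 : χ (B ⟨0, hc⟩) = 0) : χ = 0 := by
  have hB : ∀ j : Fin c, χ (B j) = 0 := by
    intro j
    have h := apply_B_eq_pow_mul B A A' χ hanti hA hA' hord1 hord2 hc j.val j.isLt
    rw [hB0, mul_zero] at h
    exact h
  funext x
  rw [Pi.zero_apply]
  by_cases h1 : ∃ j, x = B j
  · obtain ⟨j, rfl⟩ := h1; exact hB j
  by_cases h2 : ∃ j, x = A j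
  · obtain ⟨j, rfl⟩ := h2; rw [hA, hB, mul_zero]
  by_cases h3 : ∃ j, x = A' j
  · obtain ⟨j, rfl⟩ := h3; rw [hA', hB, mul_zero]
  push Not at h1 h2 h3
  exact hoff x h1 h2 h3

end Arithmetic

/-! ## 2. The gadget form and its diagonal stabiliser -/

section Gadget

variable {σ : Type*} [Fintype σ] [LinearOrder σ] {c k : ℕ}

/-- `linSubst` of a diagonal matrix on a power of a variable. [folklore] -/
theorem linSubst_diagonal_X_pow (d : σ → ℂ) (i : σ) (n : ℕ) :
    linSubst σ ℂ (Matrix.diagonal d) (X i ^ n) = C (d i ^ n) * X i ^ n := by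
  rw [map_pow, Grenet.linSubst_diagonal_X, smul_eq_C_mul, mul_pow, ← map_pow]

/-- The diagonal element of `GL σ ℂ` with nonzero diagonal entries `d`. [folklore] -/
theorem det_diagonal_ne_zero {d : σ → ℂ} (hd : ∀ i, d i ≠ 0) : (Matrix.diagonal d).det ≠ 0 := by
  rw [Matrix.det_diagonal]
  exact Finset.prod_ne_zero_iff.mpr fun i _ => hd i

/-- A diagonal element of `GL` is upper triangular. [folklore] -/
theorem isUpperTriangular_diagonal {d : σ → ℂ} (hd : ∀ i, d i ≠ 0) :
    IsUpperTriangular (Matrix.GeneralLinearGroup.mkOfDetNeZero _ (det_diagonal_ne_zero hd)) := by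
  change (Matrix.GeneralLinearGroup.mkOfDetNeZero _ (det_diagonal_ne_zero hd) : Matrix σ σ ℂ).BlockTriangular id
  rw [Matrix.GeneralLinearGroup.val_mkOfDetNeZero]
  exact Matrix.blockTriangular_diagonal _

/-- The weight character of a diagonal element is `∏ (d i)^(χ i)`. [folklore] -/
theorem weightChar_diagonal {d : σ → ℂ} (hd : ∀ i, d i ≠ 0) (χ : Weight σ) :
    weightChar χ (Matrix.GeneralLinearGroup.mkOfDetNeZero _ (det_diagonal_ne_zero hd)) =
      ∏ i, d i ^ (χ i) := by
  rw [weightChar]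
  refine Finset.prod_congr rfl fun i _ => ?_
  rw [Matrix.GeneralLinearGroup.val_mkOfDetNeZero, Matrix.diagonal_apply_eq]

/-- A diagonal scaling acts on the gadget monomial `x_B^k x_A^{2k} x_{A'}^{2k}` by the scalar
`d(B)^k d(A)^{2k} d(A')^{2k}`. [folklore] -/
theorem linSubst_diagonal_gadgetMonomial (d : σ → ℂ) (b a a' : σ) (k : ℕ) :
    linSubst σ ℂ (Matrix.diagonal d) (X b ^ k * (X a ^ (2 * k) * X a' ^ (2 * k))) =
      C (d b ^ k * (d a ^ (2 * k) * d a' ^ (2 * k))) * (X b ^ k * (X a ^ (2 * k) * X a' ^ (2 * k))) := by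
  rw [map_mul, map_mul, linSubst_diagonal_X_pow, linSubst_diagonal_X_pow, linSubst_diagonal_X_pow]
  simp only [map_mul]
  ring

/-- **Weights annihilated by the gadget's stabiliser.**  Let `g = Σ_j x_{B j}^k x_{A j}^{2k} x_{A' j}^{2k}`
(`B, A, A'` injective with pairwise disjoint images, `k ≥ 1`).  For every `j` the diagonal scalings
`(x_{B j}, x_{A j}) ↦ (4 x_{B j}, ½ x_{A j})` and `(x_{A j}, x_{A' j}) ↦ (2 x_{A j}, ½ x_{A' j})` fix `g`,
as does `x_u ↦ 2 x_u` for `u` off the gadget; consequently a weight `χ` whose character is `1` on all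
these elements satisfies `χ(A j) = 2 χ(B j)`, `χ(A' j) = χ(A j)` and `χ(u) = 0` off the gadget.  We
package this as: there is a set `S` of upper triangular elements fixing `g` such that every weight
annihilated by `S` obeys the relations. [folklore] -/
theorem exists_stabilizer_relations (B A A' : Fin c → σ) (hBi : Function.Injective B)
    (hAi : Function.Injective A) (hA'i : Function.Injective A')
    (hBA : ∀ i j, B i ≠ A j) (hBA' : ∀ i j, B i ≠ A' j) (hAA' : ∀ i j, A i ≠ A' j)
    (g : MvPolynomial σ ℂ)
    (hg : g = ∑ j : Fin c, X (B j) ^ k * (X (A j) ^ (2 * k) * X (A' j) ^ (2 * k))) :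
    ∃ S : Set (GL σ ℂ), (∀ t ∈ S, IsUpperTriangular t ∧ linSubstRep σ ℂ t g = g) ∧
      ∀ χ : Weight σ, (∀ t ∈ S, weightChar χ t = 1) →
        (∀ j, χ (A j) = 2 * χ (B j)) ∧ (∀ j, χ (A' j) = 2 * χ (B j)) ∧
        (∀ x, (∀ j, x ≠ B j) → (∀ j, x ≠ A j) → (∀ j, x ≠ A' j) → χ x = 0) := by
  classical
  -- the three families of diagonal scalings
  set d₁ : Fin c → σ → ℂ := fun j x => if x = B j then 4 else if x = A j then 2⁻¹ else 1 with hd₁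
  set d₂ : Fin c → σ → ℂ := fun j x => if x = A j then 2 else if x = A' j then 2⁻¹ else 1 with hd₂
  set d₃ : σ → σ → ℂ := fun u x => if x = u then 2 else 1 with hd₃
  have hd₁0 : ∀ j x, d₁ j x ≠ 0 := by intro j x; simp only [hd₁]; split_ifs <;> norm_num
  have hd₂0 : ∀ j x, d₂ j x ≠ 0 := by intro j x; simp only [hd₂]; split_ifs <;> norm_num
  have hd₃0 : ∀ u x, d₃ u x ≠ 0 := by intro u x; simp only [hd₃]; split_ifs <;> norm_num
  set t₁ : Fin c → GL σ ℂ := fun j =>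
    Matrix.GeneralLinearGroup.mkOfDetNeZero _ (det_diagonal_ne_zero (hd₁0 j)) with ht₁
  set t₂ : Fin c → GL σ ℂ := fun j =>
    Matrix.GeneralLinearGroup.mkOfDetNeZero _ (det_diagonal_ne_zero (hd₂0 j)) with ht₂
  set t₃ : σ → GL σ ℂ := fun u =>
    Matrix.GeneralLinearGroup.mkOfDetNeZero _ (det_diagonal_ne_zero (hd₃0 u)) with ht₃
  set off : Set σ := {u | (∀ j, u ≠ B j) ∧ (∀ j, u ≠ A j) ∧ (∀ j, u ≠ A' j)} with hoff
  refine ⟨Set.range t₁ ∪ Set.range t₂ ∪ t₃ '' off, ?_, ?_⟩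
  · -- every element is upper triangular and fixes `g`
    have hfix : ∀ (d : σ → ℂ) (hd : ∀ x, d x ≠ 0),
        (∀ j, d (B j) ^ k * (d (A j) ^ (2 * k) * d (A' j) ^ (2 * k)) = 1) →
        linSubstRep σ ℂ (Matrix.GeneralLinearGroup.mkOfDetNeZero _ (det_diagonal_ne_zero hd)) g = g := by
      intro d hd hmon
      rw [linSubstRep_apply, Matrix.GeneralLinearGroup.val_mkOfDetNeZero, hg, map_sum]
      refine Finset.sum_congr rfl fun j _ => ?_
      rw [linSubst_diagonal_gadgetMonomial, hmon j, map_one, one_mul]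
    have two_ne : (2 : ℂ) ≠ 0 := two_ne_zero
    rintro t ((⟨j, rfl⟩ | ⟨j, rfl⟩) | ⟨u, hu, rfl⟩)
    · refine ⟨isUpperTriangular_diagonal (hd₁0 j), hfix _ (hd₁0 j) fun i => ?_⟩
      by_cases hij : i = j
      · subst hij
        have h1 : d₁ i (B i) = 4 := by simp [hd₁]
        have h2 : d₁ i (A i) = 2⁻¹ := by simp [hd₁, (hBA i i).symm]
        have h3 : d₁ i (A' i) = 1 := by simp [hd₁, (hBA' i i).symm, (hAA' i i).symm]
        rw [h1, h2, h3, one_pow, mul_one, show (4 : ℂ) = 2 ^ 2 by norm_num, ← pow_mul, inv_pow]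
        exact mul_inv_cancel₀ (pow_ne_zero _ two_ne)
      · have h1 : d₁ j (B i) = 1 := by simp [hd₁, hBi.ne hij, hBA i j]
        have h2 : d₁ j (A i) = 1 := by simp [hd₁, (hBA j i).symm, hAi.ne hij]
        have h3 : d₁ j (A' i) = 1 := by simp [hd₁, (hBA' j i).symm, (hAA' j i).symm]
        rw [h1, h2, h3]; simp
    · refine ⟨isUpperTriangular_diagonal (hd₂0 j), hfix _ (hd₂0 j) fun i => ?_⟩
      by_cases hij : i = j
      · subst hij
        have h1 : d₂ i (B i) = 1 := by simp [hd₂, hBA i i, hBA' i i]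
        have h2 : d₂ i (A i) = 2 := by simp [hd₂]
        have h3 : d₂ i (A' i) = 2⁻¹ := by simp [hd₂, (hAA' i i).symm]
        rw [h1, h2, h3, one_pow, one_mul, inv_pow]
        exact mul_inv_cancel₀ (pow_ne_zero _ two_ne)
      · have h1 : d₂ j (B i) = 1 := by simp [hd₂, hBA i j, hBA' i j]
        have h2 : d₂ j (A i) = 1 := by simp [hd₂, hAi.ne hij, hAA' i j]
        have h3 : d₂ j (A' i) = 1 := by simp [hd₂, (hAA' j i).symm, hA'i.ne hij]
        rw [h1, h2, h3]; simp
    · obtain ⟨huB, huA, huA'⟩ := hu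
      refine ⟨isUpperTriangular_diagonal (hd₃0 u), hfix _ (hd₃0 u) fun i => ?_⟩
      have h1 : d₃ u (B i) = 1 := by simp [hd₃, (huB i).symm]
      have h2 : d₃ u (A i) = 1 := by simp [hd₃, (huA i).symm]
      have h3 : d₃ u (A' i) = 1 := by simp [hd₃, (huA' i).symm]
      rw [h1, h2, h3]; simp
  · -- the relations
    intro χ hχ
    have two_ne : (2 : ℂ) ≠ 0 := two_ne_zero
    -- an integer power of `2 : ℂ` equal to `1` has exponent `0`
    have hzpow : ∀ e : ℤ, (2 : ℂ) ^ e = 1 → e = 0 := by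
      intro e h
      have hn : ‖(2 : ℂ) ^ e‖ = 1 := by rw [h, norm_one]
      rw [norm_zpow, Complex.norm_two] at hn
      have hinj := zpow_right_injective₀ (by norm_num : (0 : ℝ) < 2) (by norm_num : (2 : ℝ) ≠ 1)
      exact hinj (by simpa using hn)
    -- values of the characters
    have hw₁ : ∀ j, weightChar χ (t₁ j) = (2 : ℂ) ^ (2 * χ (B j) - χ (A j)) := by
      intro j
      rw [ht₁]
      simp only []
      rw [weightChar_diagonal (hd₁0 j)]
      rw [Finset.prod_eq_mul (B j) (A j) (hBA j j) (fun x _ hx => by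
        obtain ⟨hxB, hxA⟩ := hx
        simp only [hd₁, if_neg hxB, if_neg hxA, one_zpow])
        (fun h => absurd (Finset.mem_univ _) h) (fun h => absurd (Finset.mem_univ _) h)]
      have h1 : d₁ j (B j) = 4 := by simp [hd₁]
      have h2 : d₁ j (A j) = 2⁻¹ := by simp [hd₁, (hBA j j).symm]
      rw [h1, h2, show (4 : ℂ) = 2 ^ (2 : ℤ) by norm_num, ← zpow_mul, inv_zpow', ← zpow_add₀ two_ne,
        ← sub_eq_add_neg]
    have hw₂ : ∀ j, weightChar χ (t₂ j) = (2 : ℂ) ^ (χ (A j) - χ (A' j)) := by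
      intro j
      rw [ht₂]
      simp only []
      rw [weightChar_diagonal (hd₂0 j)]
      rw [Finset.prod_eq_mul (A j) (A' j) (hAA' j j) (fun x _ hx => by
        obtain ⟨hxA, hxA'⟩ := hx
        simp only [hd₂, if_neg hxA, if_neg hxA', one_zpow])
        (fun h => absurd (Finset.mem_univ _) h) (fun h => absurd (Finset.mem_univ _) h)]
      have h1 : d₂ j (A j) = 2 := by simp [hd₂]
      have h2 : d₂ j (A' j) = 2⁻¹ := by simp [hd₂, (hAA' j j).symm]
      rw [h1, h2, inv_zpow', ← zpow_add₀ two_ne, ← sub_eq_add_neg]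
    have hw₃ : ∀ u, weightChar χ (t₃ u) = (2 : ℂ) ^ (χ u) := by
      intro u
      rw [ht₃]
      simp only []
      rw [weightChar_diagonal (hd₃0 u), Finset.prod_eq_single u (fun x _ hx => by
        simp only [hd₃, if_neg hx, one_zpow]) (fun h => absurd (Finset.mem_univ _) h)]
      simp [hd₃]
    have hrelA : ∀ j, χ (A j) = 2 * χ (B j) := by
      intro j
      have h := hχ (t₁ j) (Or.inl (Or.inl ⟨j, rfl⟩))
      rw [hw₁] at h
      have := hzpow _ h
      omega
    have hrelA' : ∀ j, χ (A' j) = 2 * χ (B j) := by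
      intro j
      have h := hχ (t₂ j) (Or.inl (Or.inr ⟨j, rfl⟩))
      rw [hw₂] at h
      have := hzpow _ h
      rw [← hrelA j]
      omega
    refine ⟨hrelA, hrelA', fun x hxB hxA hxA' => ?_⟩
    have h := hχ (t₃ x) (Or.inr ⟨x, ⟨hxB, hxA, hxA'⟩, rfl⟩)
    rw [hw₃] at h
    exact hzpow _ h

/-- **The gadget's lateness package** (hypotheses `hS`, `harith` of
`exists_late_genType_of_stabilizer`, with `D = 2^c`): for the doubling gadget `g` on interleaved
letters there is a set of upper triangular elements fixing `g` such that every NONZERO nonpositive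
antitone weight annihilated by it has `-|χ| ≥ 2^c`. [folklore] -/
theorem gadget_lateness_package (B A A' : Fin c → σ) (hc : 0 < c) (hBi : Function.Injective B)
    (hAi : Function.Injective A) (hA'i : Function.Injective A')
    (hBA : ∀ i j, B i ≠ A j) (hBA' : ∀ i j, B i ≠ A' j) (hAA' : ∀ i j, A i ≠ A' j)
    (hord1 : ∀ (j : Fin c) (h : j.val + 1 < c), A j < B ⟨j.val + 1, h⟩)
    (hord2 : ∀ (j : Fin c) (h : j.val + 1 < c), B ⟨j.val + 1, h⟩ < A' j)
    (g : MvPolynomial σ ℂ)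
    (hg : g = ∑ j : Fin c, X (B j) ^ k * (X (A j) ^ (2 * k) * X (A' j) ^ (2 * k))) :
    ∃ S : Set (GL σ ℂ), (∀ t ∈ S, IsUpperTriangular t ∧ linSubstRep σ ℂ t g = g) ∧
      ∀ χ : Weight σ, χ ≠ 0 → Antitone χ → (∀ i, χ i ≤ 0) →
        (∀ t ∈ S, weightChar χ t = 1) → (2 : ℤ) ^ c ≤ -(Weight.size χ) := by
  obtain ⟨S, hS, hrel⟩ := exists_stabilizer_relations B A A' hBi hAi hA'i hBA hBA' hAA' g hg
  refine ⟨S, hS, fun χ hne hanti hnonpos hχ => ?_⟩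
  obtain ⟨hA, hA', hoff⟩ := hrel χ hχ
  by_cases hB0 : χ (B ⟨0, hc⟩) = 0
  · exact absurd (eq_zero_of_relations B A A' χ hanti hA hA' hord1 hord2 hoff hc hB0) hne
  · exact pow_le_neg_size_of_doubling B A A' χ hanti hnonpos hA hA' hord1 hord2 hc hB0

end Gadget

end

end Summit.ValiantsHypothesis.ValiantsHypothesis.Theorems.GeneratorObstructions.PowGenDegreeQP
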